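import Literature.NumberTheory.Rogawski1990.ArchimedeanTransfer                -- ★ `archStableOrbitalIntegral`, `ArchSmooth`, `Corresponds`∕`IsStablyConj` on the `arch` carriers
import Literature.NumberTheory.Automorphic.ArchStableConjugacyLocalGlobal        -- ★ `archPiEquivCM` place components, `isStablyConj_arch_iff_forall_place`, `isStablyConj_arch_of_isConj`
import Literature.NumberTheory.Rogawski1990.ArchEndoscopicEigenvalueCompact      -- ★ p848061 (LH3-p03): `exists_forall_isRoot_charpoly_norm_le_of_isCompact` (uniform root radius on a compact family)
import Literature.NumberTheory.Rogawski1990.ArchUnitaryThreeEigenframeCompact    -- ★ p848127 (LH2-p04): the rank-3 engine `exists_isCompact_forall_isConj_of_mem_unitaryGroupOfForm_antidiag_three` (ED. 2)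
import HarnessLib

/-!
# The `G′_∞`-side of (14.2.1) is supported on the classes meeting a compact set: for `a′ ∈ C_c(G′_∞)` the stable orbital integrals
# `Φ^st(γ′, a′)` vanish at every `γ′ ↔ γ` as soon as the regular `γ ∈ G_∞` has no stable conjugate in a fixed compact `C ⊆ G_∞`
(Rogawski, *Automorphic Representations of Unitary Groups in Three Variables* (1990), §14.2 (14.2.1) pp. 232–233, §4.1 (4.1.1) p. 39, §3.1 p. 19;
Shelstad, *On geometric transfer in real twisted endoscopy*, Ann. of Math. 176 (2012), proof of Cor. 2.2 p. 1926 «vanish off the conjugacy classes meeting a set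
bounded modulo `Z₁(ℝ)`»)

Topic `NumberTheory/Rogawski1990`; namespace `Literature.NumberTheory.Rogawski1990`.  THEOREMS ONLY (no definition, no instance, no notation, no axiom, no named fact,
no `sorry`).  Cell `pub/hodgecm-mathlib`, half-A line LH2 (closer stub `stub_N8` = ★ `ArchInnerTransferCompatible`, crux H413 = `stmt-HodgeConjecture-24833`);
author LH2-p02 (g0).  The «TRANSFER SIDE BOUNDED» organ of the INNER transfer — the N8 twin of LH3's organ O2 `stub_N9transferSideBounded` — which, together with a
Schwartz-space transfer [Shelstad1979, Thm. 4.1] and Bouaziz's compactly supported replacement [Shelstad2012, Cor. 2.2 proof], reduces print's `C_c^∞` sentence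
(★ `ArchInnerTransferCompatible`, [Rogawski1990, §14.2 p. 233]) one level below print.

THE MATHEMATICS.  `G′_∞ = U(H′)(L⁺ ⊗ ℝ)`, `G_∞ = U(Φ₃)(L⁺ ⊗ ℝ)`, both inside `GL₃(L ⊗ ℝ) = Π_w GL₃(ℂ)` (★ `archPiEquivCM`).  Let `a′` have compact support `K′`.
(S1) If `Φ^st_{m′}(γ′, a′) ≠ 0` then some conjugacy class inside the stable class of `γ′` has a non-zero orbital integral, hence meets `K′`
(★ `orbitalIntegral_eq_zero_of_forall_notMem_tsupport`): `γ′` is stably conjugate to some `k′ ∈ K′`.  (S2) The roots of the characteristic polynomials of the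
place components `k′_w`, `k′ ∈ K′`, are uniformly bounded (★ `exists_forall_isRoot_charpoly_norm_le_of_isCompact`, LH3-p03: Cauchy's bound on a compact family, here
along the continuous place projections and maximised over the finitely many places); and `γ ↔ k′` (conjugate in `GL₃(L ⊗ ℝ)`) forces `charpoly γ_w = charpoly k′_w`
at every complex place `w`.  (S3) THE ENGINE, place by place — «every regular semisimple `g ∈ U(Φ₃)(ℂ)` whose
eigenvalues have absolute value `≤ R` is `GL₃(ℂ)`-conjugate into ONE compact subset of `U(Φ₃)(ℂ)`» (the two Cartan subgroups of `U(2,1)`, [Rogawski1990, §3.6 p. 31];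
LH2-p04's organ (E1³) `ArchUnitaryThreeEigenframeCompact`, the rank-3 twin of ★ `exists_isCompact_forall_isConj_of_mem_unitaryGroupOfForm_antidiag_two`) — is taken
here as the HYPOTHESIS `hE`, stated on the tree's place carriers ★ `archLocal L 3 Φ₃ w`; it is glued over the places with ★ `isStablyConj_arch_iff_forall_place`.
Conclusion: one compact `C ⊆ G_∞` such that every regular `γ` corresponding to some `γ′` with `Φ^st(γ′, a′) ≠ 0` is stably conjugate into `C`.

* §2 **`exists_forall_place_isRoot_charpoly_norm_le_of_isCompact`** — a compact `K ⊆ U(H)(L⁺ ⊗ ℝ)` has ONE eigenvalue radius for all its place components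
  (any `N`, `H`; ★ `exists_forall_isRoot_charpoly_norm_le_of_isCompact` place by place); **`charpoly_archPiEquivCM_eq_of_corresponds`** — `γ₁ ↔ γ₂` ⇒ equal place
  characteristic polynomials (any `N`, `H₁`, `H₂`).
* §3 **`exists_mem_tsupport_isStablyConj_of_archStableOrbitalIntegral_ne_zero`** — (S1) (any `N`, `H`, any family `m`, any σ-algebras).
* §4 **`exists_isCompact_forall_isStablyConj_of_isRoot_charpoly_norm_le`** — the number-field dress of the per-place engine `hE` (S3); `antidiagOne_three_map_embedding`
  (`σ_w Φ₃ = Φ₃`) and **`forall_place_engine_of_engine_three`** — the BRIDGE producing `hE` from the `GL₃(ℂ)`-level engine statement (the rank-3 twin of ★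
  `exists_isCompact_forall_isConj_of_mem_unitaryGroupOfForm_antidiag_two`), so the §5 organ becomes hypothesis-free by ONE application the hour that engine is ★.
* §5 **`exists_isCompact_archStableOrbitalIntegral_eq_zero_of_corresponds`** (compact support) ∕ `…_of_archSmooth` (★ `ArchSmooth`) — the organ text:
  `∀ a′, ∃ C ⊆ G_∞ compact, ∀ γ regular, (∀ δ, γ ∼_st δ → δ ∉ C) → ∀ γ′ ↔ γ, Φ^st_{m′}(γ′, a′) = 0`, for EVERY family `m′` (the support argument reads no measure),
  modulo `hE`.
* §6 (ED. 2, append-only; the engine is ★ p848127 `exists_isCompact_forall_isConj_of_mem_unitaryGroupOfForm_antidiag_three`, LH2-p04) — the HYPOTHESIS-FREE heads: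
  `forall_place_engine_three` (the per-place engine `hE` of §4, PROVED), **`exists_isCompact_forall_isStablyConj_of_isRoot_charpoly_norm_le'`** (S3, proved) and
  **`exists_isCompact_archStableOrbitalIntegral_eq_zero_of_corresponds'`** ∕ **`…_of_archSmooth'`** — THE ORGAN O2″ «transfer side bounded, inner», UNCONDITIONAL.
NOT here: the Schwartz transfer and Bouaziz's replacement (letters O1″ ∕ O3″ of the (o5) cut).
HONEST LABEL: HC_CM is proved only modulo the 7 printed citations (2 remaining: hLiu418 = `stmt-HodgeConjecture-24832`, h413 = `stmt-HodgeConjecture-24833`) until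
rung 0 closes; this file is support bookkeeping and proves no printed statement.

## References
* [Rogawski1990] J. D. Rogawski, *Automorphic Representations of Unitary Groups in Three Variables*, Ann. of Math. Stud. 123 (1990), §3.1 p. 19 (stable conjugacy =
  `GL_n`-conjugacy), §3.6 p. 31 (Cartan subgroups), §4.1 (4.1.1) p. 39 (`Φ^st`), §14.2 (14.2.1) pp. 232–233.
* [Shelstad2012] D. Shelstad, *On geometric transfer in real twisted endoscopy*, Ann. of Math. 176 (2012), Cor. 2.2 p. 1926 and its proof.
* [Shelstad1979] D. Shelstad, *Characters and inner forms of a quasi-split group over ℝ*, Compositio Math. 39 (1979), Thm. 4.1 p. 21.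
* [BorelJacquet1979] A. Borel, H. Jacquet, *Automorphic forms and automorphic representations*, PSPM 33.1 (1979), §4.1 (`G_∞ = Π_{v∣∞} G(F_v)`).
-/

set_option autoImplicit false

noncomputable section

-- `Classical`: the place subtype `{w // IsComplex w}` indexing `mixedSpace L` is a `Fintype` classically, as in ★ `ArchimedeanTransfer`
open Matrix NumberField NumberField.InfinitePlace NumberField.mixedEmbedding Topology Polynomial
open scoped MatrixGroups ComplexConjugate Classical

namespace Literature.NumberTheory.Rogawski1990

open Literature.NumberTheory.Automorphic

/-! ## §2 Compact subsets of `U(H)(L⁺ ⊗ ℝ)`: a uniform eigenvalue radius over all places; `γ₁ ↔ γ₂` ⇒ equal place characteristic polynomials -/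

section Places

variable (L : Type) [Field L] [NumberField L] [IsCMField L] {N : ℕ}

/-- **A compact subset of `U(H)(L⁺ ⊗ ℝ)` has ONE eigenvalue radius for all its place components**: one `R` with `‖z‖ ≤ R` for every root `z` of the characteristic
polynomial of every place component `k_w`, `k ∈ K` (★ `exists_forall_isRoot_charpoly_norm_le_of_isCompact` along each continuous place projection ★ `archPiEquivCM`,
then the maximum over the finitely many complex places). [cite: BorelJacquet1979, §4.1] [cite: HornJohnson2013, Thm 1.2.16] -/
theorem exists_forall_place_isRoot_charpoly_norm_le_of_isCompact {H : Matrix (Fin N) (Fin N) L}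
    {K : Set (UnitaryGroup.arch (↥(maximalRealSubfield L)) L (IsCMField.complexConj L) N H)} (hK : IsCompact K) :
    ∃ R : ℝ, ∀ k ∈ K, ∀ (w : {w : InfinitePlace L // IsComplex w}) (z : ℂ),
      (((UnitaryGroup.archPiEquivCM N L H k w : UnitaryGroup.archLocal L N H w) : GL (Fin N) ℂ) : Matrix (Fin N) (Fin N) ℂ).charpoly.IsRoot z → ‖z‖ ≤ R := by
  have hcont : ∀ w : {w : InfinitePlace L // IsComplex w}, Continuous fun k : UnitaryGroup.arch (↥(maximalRealSubfield L)) L (IsCMField.complexConj L) N H =>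
      (((UnitaryGroup.archPiEquivCM N L H k w : UnitaryGroup.archLocal L N H w) : GL (Fin N) ℂ) : Matrix (Fin N) (Fin N) ℂ) := fun w =>
    Units.continuous_val.comp (continuous_subtype_val.comp ((continuous_apply w).comp (UnitaryGroup.archPiEquivCM N L H).continuous))
  choose R hR using fun w => exists_forall_isRoot_charpoly_norm_le_of_isCompact hK (hcont w)
  refine ⟨∑ w, |R w|, fun k hk w z hz => (hR w k hk z hz).trans ?_⟩
  exact (le_abs_self (R w)).trans (Finset.single_le_sum (f := fun w => |R w|) (fun w _ => abs_nonneg (R w)) (Finset.mem_univ w))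

/-- **`γ₁ ↔ γ₂` forces equal place characteristic polynomials**: the correspondence ★ `Corresponds` between `U(H₁)(L⁺ ⊗ ℝ)` and `U(H₂)(L⁺ ⊗ ℝ)` is conjugacy in
`GL_N(L ⊗ ℝ)`, which the place projection `GL_N(L ⊗ ℝ) → GL_N(ℂ)` respects, and conjugate matrices have the same characteristic polynomial.
[cite: Rogawski1990, §3.1 p. 19; §14.1 p. 232] -/
theorem charpoly_archPiEquivCM_eq_of_corresponds {H₁ H₂ : Matrix (Fin N) (Fin N) L}
    {γ₁ : UnitaryGroup.arch (↥(maximalRealSubfield L)) L (IsCMField.complexConj L) N H₁}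
    {γ₂ : UnitaryGroup.arch (↥(maximalRealSubfield L)) L (IsCMField.complexConj L) N H₂}
    (h : Corresponds (UnitaryGroup.conjMixed (↥(maximalRealSubfield L)) L (IsCMField.complexConj L))
      (UnitaryGroup.archFormOf L N H₁) (UnitaryGroup.archFormOf L N H₂) γ₁ γ₂)
    (w : {w : InfinitePlace L // IsComplex w}) :
    (((UnitaryGroup.archPiEquivCM N L H₁ γ₁ w : UnitaryGroup.archLocal L N H₁ w) : GL (Fin N) ℂ) : Matrix (Fin N) (Fin N) ℂ).charpoly =
      (((UnitaryGroup.archPiEquivCM N L H₂ γ₂ w : UnitaryGroup.archLocal L N H₂ w) : GL (Fin N) ℂ) : Matrix (Fin N) (Fin N) ℂ).charpoly := by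
  have hc : IsConj (Matrix.GeneralLinearGroup.map (UnitaryGroup.evalC L w) (γ₁ : GL (Fin N) (mixedSpace L)))
      (Matrix.GeneralLinearGroup.map (UnitaryGroup.evalC L w) (γ₂ : GL (Fin N) (mixedSpace L))) :=
    (Matrix.GeneralLinearGroup.map (n := Fin N) (UnitaryGroup.evalC L w)).map_isConj h
  obtain ⟨c, hc⟩ := isConj_iff.1 hc
  rw [UnitaryGroup.coe_archPiEquivCM_apply, UnitaryGroup.coe_archPiEquivCM_apply, ← hc, Units.val_mul, Units.val_mul, Matrix.coe_units_inv,
    Matrix.charpoly_units_conj]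

end Places

/-! ## §3 (S1) A non-zero stable orbital integral meets the support -/

section Support

variable (L : Type) [Field L] [NumberField L] [IsCMField L] {N : ℕ} {H : Matrix (Fin N) (Fin N) L}

/-- **(S1) `Φ^st_m(γ, a) ≠ 0` ⇒ `γ` is stably conjugate to a point of `tsupport a`**: the stable orbital integral is the `finsum` over the classes `c` inside
the stable class of `γ` of the orbital integrals `Φ_m(c, a)` (★ `archStableOrbitalIntegral`, (4.1.1)); a non-zero summand `Φ_m(c, a) ≠ 0` forces a conjugate of
`out c` to lie in `tsupport a` (★ `orbitalIntegral_eq_zero_of_forall_notMem_tsupport`), and conjugate elements are stably conjugate.  For EVERY family `m` and every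
σ-algebra on the orbit quotients. [cite: Rogawski1990, §4.1 (4.1.1) p. 39; §3.1 p. 19] -/
theorem exists_mem_tsupport_isStablyConj_of_archStableOrbitalIntegral_ne_zero
    {_hγ : ∀ γ : UnitaryGroup.arch (↥(maximalRealSubfield L)) L (IsCMField.complexConj L) N H,
      MeasurableSpace (UnitaryGroup.arch (↥(maximalRealSubfield L)) L (IsCMField.complexConj L) N H ⧸
        Subgroup.centralizer ({γ} : Set (UnitaryGroup.arch (↥(maximalRealSubfield L)) L (IsCMField.complexConj L) N H)))}
    (m : OrbitalMeasureFamily (UnitaryGroup.arch (↥(maximalRealSubfield L)) L (IsCMField.complexConj L) N H))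
    {a : UnitaryGroup.arch (↥(maximalRealSubfield L)) L (IsCMField.complexConj L) N H → ℂ}
    {γ : UnitaryGroup.arch (↥(maximalRealSubfield L)) L (IsCMField.complexConj L) N H}
    (h : archStableOrbitalIntegral L N H m a γ ≠ 0) :
    ∃ k ∈ tsupport a, IsStablyConj (UnitaryGroup.conjMixed (↥(maximalRealSubfield L)) L (IsCMField.complexConj L)) (UnitaryGroup.archFormOf L N H) γ k := by
  by_contra hno
  push Not at hno
  refine h ?_
  rw [archStableOrbitalIntegral, stableOrbitalIntegralRel_def]
  -- no conjugate of a representative `out c` of a class inside the stable class of `γ` meets `tsupport a`: each would be stably conjugate to `γ`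
  have hzero : ∀ c ∈ {c : ConjClasses (UnitaryGroup.arch (↥(maximalRealSubfield L)) L (IsCMField.complexConj L) N H) |
      IsStablyConj (UnitaryGroup.conjMixed (↥(maximalRealSubfield L)) L (IsCMField.complexConj L)) (UnitaryGroup.archFormOf L N H) γ (Quotient.out c)},
      classOrbitalIntegral m a c = (0 : ConjClasses (UnitaryGroup.arch (↥(maximalRealSubfield L)) L (IsCMField.complexConj L) N H) → ℂ) c := by
    intro c hc
    rw [Pi.zero_apply, classOrbitalIntegral_eq]
    refine orbitalIntegral_eq_zero_of_forall_notMem_tsupport _ _ fun g hg => hno _ hg ?_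
    exact IsStablyConj.trans hc (UnitaryGroup.isStablyConj_arch_of_isConj L N H (isConj_iff.2 ⟨g, rfl⟩))
  exact finsum_mem_of_eqOn_zero hzero

end Support

/-! ## §4 (S3) The number-field dress of the per-place engine: bounded eigenvalues ⇒ stably conjugate into one compact subset of `G_∞` -/

section Dress

variable (L : Type) [Field L] [NumberField L] [IsCMField L]

/-- **(S3) Regular elements of `G_∞ = U(Φ₃)(L⁺ ⊗ ℝ)` with place eigenvalues of absolute value `≤ R` are stably conjugate into ONE compact `C ⊆ G_∞`** — GIVEN the
per-place engine `hE` («at each complex place `w`, every regular semisimple `g ∈ U(σ_w Φ₃)(ℂ)` with eigenvalues of absolute value `≤ R` is stably conjugate into a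
compact `C_w ⊆ U(σ_w Φ₃)(ℂ)`»: the two Cartan subgroups of `U(2,1)`; LH2-p04's `ArchUnitaryThreeEigenframeCompact`): `C` is the image of `Π_w C_w` under
★ `archPiEquivCM⁻¹`, regularity passes to the places (`charpoly` commutes with the place projection, separability with ring maps), and stable conjugacy in `G_∞` is
checked place by place (★ `isStablyConj_arch_iff_forall_place`). [cite: Rogawski1990, §3.6 p. 31; §3.1 p. 19] [cite: BorelJacquet1979, §4.1] -/
theorem exists_isCompact_forall_isStablyConj_of_isRoot_charpoly_norm_le
    (hE : ∀ (w : {w : InfinitePlace L // IsComplex w}) (R : ℝ),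
      ∃ C : Set (UnitaryGroup.archLocal L 3 (Matrix.of fun i j : Fin 3 => if i.val + j.val + 1 = 3 then (1 : L) else 0) w), IsCompact C ∧
        ∀ g : UnitaryGroup.archLocal L 3 (Matrix.of fun i j : Fin 3 => if i.val + j.val + 1 = 3 then (1 : L) else 0) w,
          ((g : GL (Fin 3) ℂ) : Matrix (Fin 3) (Fin 3) ℂ).charpoly.Separable →
            (∀ z : ℂ, ((g : GL (Fin 3) ℂ) : Matrix (Fin 3) (Fin 3) ℂ).charpoly.IsRoot z → ‖z‖ ≤ R) →
              ∃ δ ∈ C, IsStablyConj (starRingEnd ℂ) ((Matrix.of fun i j : Fin 3 => if i.val + j.val + 1 = 3 then (1 : L) else 0).map w.1.embedding) g δ)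
    (R : ℝ) :
    ∃ C : Set (UnitaryGroup.arch (↥(maximalRealSubfield L)) L (IsCMField.complexConj L) 3 (Matrix.of fun i j : Fin 3 => if i.val + j.val + 1 = 3 then (1 : L) else 0)),
      IsCompact C ∧
        ∀ γ : UnitaryGroup.arch (↥(maximalRealSubfield L)) L (IsCMField.complexConj L) 3 (Matrix.of fun i j : Fin 3 => if i.val + j.val + 1 = 3 then (1 : L) else 0),
          IsRegularElt (γ : GL (Fin 3) (mixedSpace L)) →
            (∀ (w : {w : InfinitePlace L // IsComplex w}) (z : ℂ),
              (((UnitaryGroup.archPiEquivCM 3 L (Matrix.of fun i j : Fin 3 => if i.val + j.val + 1 = 3 then (1 : L) else 0) γ w :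
                UnitaryGroup.archLocal L 3 (Matrix.of fun i j : Fin 3 => if i.val + j.val + 1 = 3 then (1 : L) else 0) w) : GL (Fin 3) ℂ) :
                  Matrix (Fin 3) (Fin 3) ℂ).charpoly.IsRoot z → ‖z‖ ≤ R) →
              ∃ δ ∈ C, IsStablyConj (UnitaryGroup.conjMixed (↥(maximalRealSubfield L)) L (IsCMField.complexConj L))
                (UnitaryGroup.archFormOf L 3 (Matrix.of fun i j : Fin 3 => if i.val + j.val + 1 = 3 then (1 : L) else 0)) γ δ := by
  choose C hC hE' using fun w => hE w R
  set e := UnitaryGroup.archPiEquivCM 3 L (Matrix.of fun i j : Fin 3 => if i.val + j.val + 1 = 3 then (1 : L) else 0) with he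
  refine ⟨e.symm '' Set.pi Set.univ C, (isCompact_univ_pi hC).image e.symm.continuous, fun γ hreg hR => ?_⟩
  -- regularity place by place: the place characteristic polynomial is the image of the global one under `evalC w`
  have hsep : ∀ w : {w : InfinitePlace L // IsComplex w},
      (((e γ w : UnitaryGroup.archLocal L 3 (Matrix.of fun i j : Fin 3 => if i.val + j.val + 1 = 3 then (1 : L) else 0) w) : GL (Fin 3) ℂ) :
        Matrix (Fin 3) (Fin 3) ℂ).charpoly.Separable := by
    intro w
    have hmap : (((e γ w : UnitaryGroup.archLocal L 3 (Matrix.of fun i j : Fin 3 => if i.val + j.val + 1 = 3 then (1 : L) else 0) w) : GL (Fin 3) ℂ) :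
        Matrix (Fin 3) (Fin 3) ℂ) = (((γ : GL (Fin 3) (mixedSpace L)) : Matrix (Fin 3) (Fin 3) (mixedSpace L))).map (UnitaryGroup.evalC L w) := by
      rw [he, UnitaryGroup.coe_archPiEquivCM_apply]
      rfl
    rw [hmap, Matrix.charpoly_map]
    exact ((isRegularElt_iff _).1 hreg).map
  choose δ hδC hδ using fun w => hE' w (e γ w) (hsep w) (hR w)
  refine ⟨e.symm δ, ⟨δ, fun w _ => hδC w, rfl⟩, ?_⟩
  refine (UnitaryGroup.isStablyConj_arch_iff_forall_place L 3 _ γ (e.symm δ)).2 fun w => ?_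
  have happ : UnitaryGroup.archPiEquivCM 3 L (Matrix.of fun i j : Fin 3 => if i.val + j.val + 1 = 3 then (1 : L) else 0) (e.symm δ) w = δ w := by
    rw [he, ContinuousMulEquiv.apply_symm_apply]
  rw [happ]
  exact hδ w


omit [NumberField L] [IsCMField L] in
/-- **`σ_w(Φ₃) = Φ₃`**: the antidiagonal unit form has rational entries `0, 1`, fixed by every complex embedding. [cite: Rogawski1990, §14.2 p. 232] -/
theorem antidiagOne_three_map_embedding (w : {w : InfinitePlace L // IsComplex w}) :
    (Matrix.of fun i j : Fin 3 => if i.val + j.val + 1 = 3 then (1 : L) else 0).map w.1.embedding =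
      Matrix.of fun i j : Fin 3 => if i.val + j.val + 1 = 3 then (1 : ℂ) else 0 := by
  ext i j
  simp only [Matrix.map_apply, Matrix.of_apply]
  split_ifs <;> simp

omit [NumberField L] [IsCMField L] in
/-- **BRIDGE from the `GL₃(ℂ)`-level engine to the place hypothesis `hE` of §4**: the rank-3 twin of ★
`exists_isCompact_forall_isConj_of_mem_unitaryGroupOfForm_antidiag_two` (LH2-p04's (E1³): for every `R` one compact `C ⊆ GL₃(ℂ)` inside `U(Φ₃)(ℂ)` receiving, up
to `GL₃(ℂ)`-conjugacy, every regular semisimple `g ∈ U(Φ₃)(ℂ)` with eigenvalues of absolute value `≤ R`) yields `hE` at every complex place `w`: `U(σ_w Φ₃)(ℂ) =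
U(Φ₃)(ℂ)` (`antidiagOne_three_map_embedding`), `C` pulls back to a compact subset of the closed subgroup ★ `archLocal L 3 Φ₃ w` (★ `isClosed_archLocal`), and stable
conjugacy there IS `GL₃(ℂ)`-conjugacy. [cite: Rogawski1990, §3.6 p. 31; §3.1 p. 19] -/
theorem forall_place_engine_of_engine_three
    (hE3 : ∀ R : ℝ, ∃ C : Set (GL (Fin 3) ℂ), IsCompact C ∧
      C ⊆ (unitaryGroupOfForm (starRingEnd ℂ) (Matrix.of fun i j : Fin 3 => if i.val + j.val + 1 = 3 then (1 : ℂ) else 0) : Set (GL (Fin 3) ℂ)) ∧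
      ∀ g : GL (Fin 3) ℂ, g ∈ unitaryGroupOfForm (starRingEnd ℂ) (Matrix.of fun i j : Fin 3 => if i.val + j.val + 1 = 3 then (1 : ℂ) else 0) →
        (g : Matrix (Fin 3) (Fin 3) ℂ).charpoly.Separable →
        (∀ z : ℂ, (g : Matrix (Fin 3) (Fin 3) ℂ).charpoly.IsRoot z → ‖z‖ ≤ R) →
          ∃ δ ∈ C, IsConj g δ)
    (w : {w : InfinitePlace L // IsComplex w}) (R : ℝ) :
    ∃ C : Set (UnitaryGroup.archLocal L 3 (Matrix.of fun i j : Fin 3 => if i.val + j.val + 1 = 3 then (1 : L) else 0) w), IsCompact C ∧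
      ∀ g : UnitaryGroup.archLocal L 3 (Matrix.of fun i j : Fin 3 => if i.val + j.val + 1 = 3 then (1 : L) else 0) w,
        ((g : GL (Fin 3) ℂ) : Matrix (Fin 3) (Fin 3) ℂ).charpoly.Separable →
          (∀ z : ℂ, ((g : GL (Fin 3) ℂ) : Matrix (Fin 3) (Fin 3) ℂ).charpoly.IsRoot z → ‖z‖ ≤ R) →
            ∃ δ ∈ C, IsStablyConj (starRingEnd ℂ) ((Matrix.of fun i j : Fin 3 => if i.val + j.val + 1 = 3 then (1 : L) else 0).map w.1.embedding) g δ := by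
  obtain ⟨C, hC, hCsub, hrep⟩ := hE3 R
  -- `U(σ_w Φ₃)(ℂ) = U(Φ₃)(ℂ)` as subgroups of `GL₃(ℂ)`
  have hU : UnitaryGroup.archLocal L 3 (Matrix.of fun i j : Fin 3 => if i.val + j.val + 1 = 3 then (1 : L) else 0) w =
      unitaryGroupOfForm (starRingEnd ℂ) (Matrix.of fun i j : Fin 3 => if i.val + j.val + 1 = 3 then (1 : ℂ) else 0) := by
    unfold UnitaryGroup.archLocal
    rw [antidiagOne_three_map_embedding]
  have hcl : Topology.IsClosedEmbedding (Subtype.val :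
      UnitaryGroup.archLocal L 3 (Matrix.of fun i j : Fin 3 => if i.val + j.val + 1 = 3 then (1 : L) else 0) w → GL (Fin 3) ℂ) :=
    Topology.IsClosedEmbedding.subtypeVal (UnitaryGroup.isClosed_archLocal L 3 _ w)
  refine ⟨Subtype.val ⁻¹' C, hcl.isCompact_preimage hC, fun g hsep hR => ?_⟩
  have hg : (g : GL (Fin 3) ℂ) ∈ unitaryGroupOfForm (starRingEnd ℂ) (Matrix.of fun i j : Fin 3 => if i.val + j.val + 1 = 3 then (1 : ℂ) else 0) := by
    rw [← hU]
    exact g.2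
  obtain ⟨δ, hδC, hδ⟩ := hrep (g : GL (Fin 3) ℂ) hg hsep hR
  have hδU : δ ∈ UnitaryGroup.archLocal L 3 (Matrix.of fun i j : Fin 3 => if i.val + j.val + 1 = 3 then (1 : L) else 0) w := by
    rw [hU]
    exact hCsub hδC
  exact ⟨⟨δ, hδU⟩, hδC, hδ⟩

end Dress

/-! ## §5 The organ: the `G′_∞`-side of (14.2.1) vanishes off the classes meeting a compact set -/

section Organ

variable (L : Type) [Field L] [NumberField L] [IsCMField L] (H' : Matrix (Fin 3) (Fin 3) L)

/-- **THE TRANSFER SIDE OF (14.2.1) IS SUPPORTED ON THE CLASSES MEETING A COMPACT SET** (modulo the per-place engine `hE` of §4): for every compactly supported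
`a′` on `G′_∞ = U(H′)(L⁺ ⊗ ℝ)` there is a compact `C ⊆ G_∞ = U(Φ₃)(L⁺ ⊗ ℝ)` such that `Φ^st_{m′}(γ′, a′) = 0` for every `γ′ ↔ γ` whenever the regular `γ ∈ G_∞` has NO
stable conjugate in `C` — for EVERY family `m′` and every σ-algebra on the orbit quotients.  Proof: `K′ = tsupport a′` is compact; (S2) gives a uniform eigenvalue
radius `R` for the place components of `K′`; (S3) gives `C` for `R`; if `Φ^st(γ′, a′) ≠ 0`, (S1) makes `γ′` stably conjugate to some `k′ ∈ K′`, so `k′ ↔ γ`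
(★ `Corresponds.of_isStablyConj_left`), the place characteristic polynomials of `γ` and `k′` agree (§2), the eigenvalues of `γ` are bounded by `R`, and `γ` is
stably conjugate into `C` — contradiction.  The «bounded modulo `Z₁(ℝ)`» clause of the proof of [Shelstad2012, Cor. 2.2] for the inner transfer, where the
centre of `G_∞` is compact. [cite: Rogawski1990, §14.2 (14.2.1) pp. 232–233; §4.1 (4.1.1) p. 39] [cite: Shelstad2012, Cor. 2.2 p. 1926] -/
theorem exists_isCompact_archStableOrbitalIntegral_eq_zero_of_corresponds
    (hE : ∀ (w : {w : InfinitePlace L // IsComplex w}) (R : ℝ),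
      ∃ C : Set (UnitaryGroup.archLocal L 3 (Matrix.of fun i j : Fin 3 => if i.val + j.val + 1 = 3 then (1 : L) else 0) w), IsCompact C ∧
        ∀ g : UnitaryGroup.archLocal L 3 (Matrix.of fun i j : Fin 3 => if i.val + j.val + 1 = 3 then (1 : L) else 0) w,
          ((g : GL (Fin 3) ℂ) : Matrix (Fin 3) (Fin 3) ℂ).charpoly.Separable →
            (∀ z : ℂ, ((g : GL (Fin 3) ℂ) : Matrix (Fin 3) (Fin 3) ℂ).charpoly.IsRoot z → ‖z‖ ≤ R) →
              ∃ δ ∈ C, IsStablyConj (starRingEnd ℂ) ((Matrix.of fun i j : Fin 3 => if i.val + j.val + 1 = 3 then (1 : L) else 0).map w.1.embedding) g δ)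
    {_hγ' : ∀ γ : UnitaryGroup.arch (↥(maximalRealSubfield L)) L (IsCMField.complexConj L) 3 H',
      MeasurableSpace (UnitaryGroup.arch (↥(maximalRealSubfield L)) L (IsCMField.complexConj L) 3 H' ⧸
        Subgroup.centralizer ({γ} : Set (UnitaryGroup.arch (↥(maximalRealSubfield L)) L (IsCMField.complexConj L) 3 H')))}
    (m' : OrbitalMeasureFamily (UnitaryGroup.arch (↥(maximalRealSubfield L)) L (IsCMField.complexConj L) 3 H'))
    {a' : UnitaryGroup.arch (↥(maximalRealSubfield L)) L (IsCMField.complexConj L) 3 H' → ℂ} (ha' : HasCompactSupport a') :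
    ∃ C : Set (UnitaryGroup.arch (↥(maximalRealSubfield L)) L (IsCMField.complexConj L) 3 (Matrix.of fun i j : Fin 3 => if i.val + j.val + 1 = 3 then (1 : L) else 0)),
      IsCompact C ∧
        ∀ γ : UnitaryGroup.arch (↥(maximalRealSubfield L)) L (IsCMField.complexConj L) 3 (Matrix.of fun i j : Fin 3 => if i.val + j.val + 1 = 3 then (1 : L) else 0),
          IsRegularElt (γ : GL (Fin 3) (mixedSpace L)) →
            (∀ δ : UnitaryGroup.arch (↥(maximalRealSubfield L)) L (IsCMField.complexConj L) 3 (Matrix.of fun i j : Fin 3 => if i.val + j.val + 1 = 3 then (1 : L) else 0),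
              IsStablyConj (UnitaryGroup.conjMixed (↥(maximalRealSubfield L)) L (IsCMField.complexConj L))
                (UnitaryGroup.archFormOf L 3 (Matrix.of fun i j : Fin 3 => if i.val + j.val + 1 = 3 then (1 : L) else 0)) γ δ → δ ∉ C) →
              ∀ γ' : UnitaryGroup.arch (↥(maximalRealSubfield L)) L (IsCMField.complexConj L) 3 H',
                Corresponds (UnitaryGroup.conjMixed (↥(maximalRealSubfield L)) L (IsCMField.complexConj L)) (UnitaryGroup.archFormOf L 3 H')
                  (UnitaryGroup.archFormOf L 3 (Matrix.of fun i j : Fin 3 => if i.val + j.val + 1 = 3 then (1 : L) else 0)) γ' γ →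
                  archStableOrbitalIntegral L 3 H' m' a' γ' = 0 := by
  obtain ⟨R, hR⟩ := exists_forall_place_isRoot_charpoly_norm_le_of_isCompact L (K := tsupport a') ha'
  obtain ⟨C, hC, hS3⟩ := exists_isCompact_forall_isStablyConj_of_isRoot_charpoly_norm_le L hE R
  refine ⟨C, hC, fun γ hreg hno γ' hcorr => ?_⟩
  by_contra hne
  obtain ⟨k, hk, hst⟩ := exists_mem_tsupport_isStablyConj_of_archStableOrbitalIntegral_ne_zero L m' hne
  have hck : Corresponds (UnitaryGroup.conjMixed (↥(maximalRealSubfield L)) L (IsCMField.complexConj L)) (UnitaryGroup.archFormOf L 3 H')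
      (UnitaryGroup.archFormOf L 3 (Matrix.of fun i j : Fin 3 => if i.val + j.val + 1 = 3 then (1 : L) else 0)) k γ :=
    hcorr.of_isStablyConj_left hst
  have hroots : ∀ (w : {w : InfinitePlace L // IsComplex w}) (z : ℂ),
      (((UnitaryGroup.archPiEquivCM 3 L (Matrix.of fun i j : Fin 3 => if i.val + j.val + 1 = 3 then (1 : L) else 0) γ w :
        UnitaryGroup.archLocal L 3 (Matrix.of fun i j : Fin 3 => if i.val + j.val + 1 = 3 then (1 : L) else 0) w) : GL (Fin 3) ℂ) :
          Matrix (Fin 3) (Fin 3) ℂ).charpoly.IsRoot z → ‖z‖ ≤ R := by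
    intro w z hz
    refine hR k hk w z ?_
    rwa [charpoly_archPiEquivCM_eq_of_corresponds L hck w]
  obtain ⟨δ, hδC, hδ⟩ := hS3 γ hreg hroots
  exact hno δ hδ hδC

/-- The same for `a′ ∈ C_c^∞(G′_∞)` (★ `ArchSmooth`, ★ `ArchSmooth.hasCompactSupport`) — the binder shape of the LH2 pay-down skeleton's organ texts.
[cite: Rogawski1990, §14.2 (14.2.1) pp. 232–233] [cite: Shelstad2012, Cor. 2.2 p. 1926] -/
theorem exists_isCompact_archStableOrbitalIntegral_eq_zero_of_corresponds_of_archSmooth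
    (hE : ∀ (w : {w : InfinitePlace L // IsComplex w}) (R : ℝ),
      ∃ C : Set (UnitaryGroup.archLocal L 3 (Matrix.of fun i j : Fin 3 => if i.val + j.val + 1 = 3 then (1 : L) else 0) w), IsCompact C ∧
        ∀ g : UnitaryGroup.archLocal L 3 (Matrix.of fun i j : Fin 3 => if i.val + j.val + 1 = 3 then (1 : L) else 0) w,
          ((g : GL (Fin 3) ℂ) : Matrix (Fin 3) (Fin 3) ℂ).charpoly.Separable →
            (∀ z : ℂ, ((g : GL (Fin 3) ℂ) : Matrix (Fin 3) (Fin 3) ℂ).charpoly.IsRoot z → ‖z‖ ≤ R) →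
              ∃ δ ∈ C, IsStablyConj (starRingEnd ℂ) ((Matrix.of fun i j : Fin 3 => if i.val + j.val + 1 = 3 then (1 : L) else 0).map w.1.embedding) g δ)
    {_hγ' : ∀ γ : UnitaryGroup.arch (↥(maximalRealSubfield L)) L (IsCMField.complexConj L) 3 H',
      MeasurableSpace (UnitaryGroup.arch (↥(maximalRealSubfield L)) L (IsCMField.complexConj L) 3 H' ⧸
        Subgroup.centralizer ({γ} : Set (UnitaryGroup.arch (↥(maximalRealSubfield L)) L (IsCMField.complexConj L) 3 H')))}
    (m' : OrbitalMeasureFamily (UnitaryGroup.arch (↥(maximalRealSubfield L)) L (IsCMField.complexConj L) 3 H'))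
    {a' : UnitaryGroup.arch (↥(maximalRealSubfield L)) L (IsCMField.complexConj L) 3 H' → ℂ} (ha' : ArchSmooth L 3 H' a') :
    ∃ C : Set (UnitaryGroup.arch (↥(maximalRealSubfield L)) L (IsCMField.complexConj L) 3 (Matrix.of fun i j : Fin 3 => if i.val + j.val + 1 = 3 then (1 : L) else 0)),
      IsCompact C ∧
        ∀ γ : UnitaryGroup.arch (↥(maximalRealSubfield L)) L (IsCMField.complexConj L) 3 (Matrix.of fun i j : Fin 3 => if i.val + j.val + 1 = 3 then (1 : L) else 0),
          IsRegularElt (γ : GL (Fin 3) (mixedSpace L)) →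
            (∀ δ : UnitaryGroup.arch (↥(maximalRealSubfield L)) L (IsCMField.complexConj L) 3 (Matrix.of fun i j : Fin 3 => if i.val + j.val + 1 = 3 then (1 : L) else 0),
              IsStablyConj (UnitaryGroup.conjMixed (↥(maximalRealSubfield L)) L (IsCMField.complexConj L))
                (UnitaryGroup.archFormOf L 3 (Matrix.of fun i j : Fin 3 => if i.val + j.val + 1 = 3 then (1 : L) else 0)) γ δ → δ ∉ C) →
              ∀ γ' : UnitaryGroup.arch (↥(maximalRealSubfield L)) L (IsCMField.complexConj L) 3 H',
                Corresponds (UnitaryGroup.conjMixed (↥(maximalRealSubfield L)) L (IsCMField.complexConj L)) (UnitaryGroup.archFormOf L 3 H')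
                  (UnitaryGroup.archFormOf L 3 (Matrix.of fun i j : Fin 3 => if i.val + j.val + 1 = 3 then (1 : L) else 0)) γ' γ →
                  archStableOrbitalIntegral L 3 H' m' a' γ' = 0 :=
  exists_isCompact_archStableOrbitalIntegral_eq_zero_of_corresponds L H' hE m' ha'.hasCompactSupport

end Organ

/-! ## §6 (ED. 2) The hypothesis-free organ: the rank-3 engine is ★ `exists_isCompact_forall_isConj_of_mem_unitaryGroupOfForm_antidiag_three` (LH2-p04) -/

section Unconditional

variable (L : Type) [Field L] [NumberField L] [IsCMField L] (H' : Matrix (Fin 3) (Fin 3) L)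

omit [NumberField L] [IsCMField L] in
/-- **The per-place engine, PROVED**: at every complex place `w` and for every radius `R`, one compact subset of `U(σ_w Φ₃)(ℂ)` receives, up to stable
(= `GL₃(ℂ)`-) conjugacy, every regular semisimple element with eigenvalues of absolute value `≤ R` (★ `exists_isCompact_forall_isConj_of_mem_unitaryGroupOfForm_antidiag_three`
through the bridge `forall_place_engine_of_engine_three`). [cite: Rogawski1990, §3.6 p. 31; §3.1 p. 19] -/
theorem forall_place_engine_three (w : {w : InfinitePlace L // IsComplex w}) (R : ℝ) :
    ∃ C : Set (UnitaryGroup.archLocal L 3 (Matrix.of fun i j : Fin 3 => if i.val + j.val + 1 = 3 then (1 : L) else 0) w), IsCompact C ∧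
      ∀ g : UnitaryGroup.archLocal L 3 (Matrix.of fun i j : Fin 3 => if i.val + j.val + 1 = 3 then (1 : L) else 0) w,
        ((g : GL (Fin 3) ℂ) : Matrix (Fin 3) (Fin 3) ℂ).charpoly.Separable →
          (∀ z : ℂ, ((g : GL (Fin 3) ℂ) : Matrix (Fin 3) (Fin 3) ℂ).charpoly.IsRoot z → ‖z‖ ≤ R) →
            ∃ δ ∈ C, IsStablyConj (starRingEnd ℂ) ((Matrix.of fun i j : Fin 3 => if i.val + j.val + 1 = 3 then (1 : L) else 0).map w.1.embedding) g δ :=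
  forall_place_engine_of_engine_three L exists_isCompact_forall_isConj_of_mem_unitaryGroupOfForm_antidiag_three w R

/-- **(S3), PROVED**: regular elements of `G_∞ = U(Φ₃)(L⁺ ⊗ ℝ)` whose place eigenvalues have absolute value `≤ R` are stably conjugate into ONE compact `C ⊆ G_∞`.
[cite: Rogawski1990, §3.6 p. 31; §3.1 p. 19] [cite: BorelJacquet1979, §4.1] -/
theorem exists_isCompact_forall_isStablyConj_of_isRoot_charpoly_norm_le' (R : ℝ) :
    ∃ C : Set (UnitaryGroup.arch (↥(maximalRealSubfield L)) L (IsCMField.complexConj L) 3 (Matrix.of fun i j : Fin 3 => if i.val + j.val + 1 = 3 then (1 : L) else 0)),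
      IsCompact C ∧
        ∀ γ : UnitaryGroup.arch (↥(maximalRealSubfield L)) L (IsCMField.complexConj L) 3 (Matrix.of fun i j : Fin 3 => if i.val + j.val + 1 = 3 then (1 : L) else 0),
          IsRegularElt (γ : GL (Fin 3) (mixedSpace L)) →
            (∀ (w : {w : InfinitePlace L // IsComplex w}) (z : ℂ),
              (((UnitaryGroup.archPiEquivCM 3 L (Matrix.of fun i j : Fin 3 => if i.val + j.val + 1 = 3 then (1 : L) else 0) γ w :
                UnitaryGroup.archLocal L 3 (Matrix.of fun i j : Fin 3 => if i.val + j.val + 1 = 3 then (1 : L) else 0) w) : GL (Fin 3) ℂ) :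
                  Matrix (Fin 3) (Fin 3) ℂ).charpoly.IsRoot z → ‖z‖ ≤ R) →
              ∃ δ ∈ C, IsStablyConj (UnitaryGroup.conjMixed (↥(maximalRealSubfield L)) L (IsCMField.complexConj L))
                (UnitaryGroup.archFormOf L 3 (Matrix.of fun i j : Fin 3 => if i.val + j.val + 1 = 3 then (1 : L) else 0)) γ δ :=
  exists_isCompact_forall_isStablyConj_of_isRoot_charpoly_norm_le L (forall_place_engine_three L) R

/-- **THE ORGAN O2″ «TRANSFER SIDE BOUNDED, INNER», UNCONDITIONAL** (compact support): for every compactly supported `a′` on `G′_∞ = U(H′)(L⁺ ⊗ ℝ)` there is a compact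
`C ⊆ G_∞ = U(Φ₃)(L⁺ ⊗ ℝ)` such that `Φ^st_{m′}(γ′, a′) = 0` for every `γ′ ↔ γ` whenever the regular `γ ∈ G_∞` has no stable conjugate in `C` — EVERY family `m′`, every
σ-algebra on the orbit quotients. [cite: Rogawski1990, §14.2 (14.2.1) pp. 232–233; §4.1 (4.1.1) p. 39] [cite: Shelstad2012, Cor. 2.2 p. 1926] -/
theorem exists_isCompact_archStableOrbitalIntegral_eq_zero_of_corresponds'
    {_hγ' : ∀ γ : UnitaryGroup.arch (↥(maximalRealSubfield L)) L (IsCMField.complexConj L) 3 H',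
      MeasurableSpace (UnitaryGroup.arch (↥(maximalRealSubfield L)) L (IsCMField.complexConj L) 3 H' ⧸
        Subgroup.centralizer ({γ} : Set (UnitaryGroup.arch (↥(maximalRealSubfield L)) L (IsCMField.complexConj L) 3 H')))}
    (m' : OrbitalMeasureFamily (UnitaryGroup.arch (↥(maximalRealSubfield L)) L (IsCMField.complexConj L) 3 H'))
    {a' : UnitaryGroup.arch (↥(maximalRealSubfield L)) L (IsCMField.complexConj L) 3 H' → ℂ} (ha' : HasCompactSupport a') :
    ∃ C : Set (UnitaryGroup.arch (↥(maximalRealSubfield L)) L (IsCMField.complexConj L) 3 (Matrix.of fun i j : Fin 3 => if i.val + j.val + 1 = 3 then (1 : L) else 0)),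
      IsCompact C ∧
        ∀ γ : UnitaryGroup.arch (↥(maximalRealSubfield L)) L (IsCMField.complexConj L) 3 (Matrix.of fun i j : Fin 3 => if i.val + j.val + 1 = 3 then (1 : L) else 0),
          IsRegularElt (γ : GL (Fin 3) (mixedSpace L)) →
            (∀ δ : UnitaryGroup.arch (↥(maximalRealSubfield L)) L (IsCMField.complexConj L) 3 (Matrix.of fun i j : Fin 3 => if i.val + j.val + 1 = 3 then (1 : L) else 0),
              IsStablyConj (UnitaryGroup.conjMixed (↥(maximalRealSubfield L)) L (IsCMField.complexConj L))
                (UnitaryGroup.archFormOf L 3 (Matrix.of fun i j : Fin 3 => if i.val + j.val + 1 = 3 then (1 : L) else 0)) γ δ → δ ∉ C) →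
              ∀ γ' : UnitaryGroup.arch (↥(maximalRealSubfield L)) L (IsCMField.complexConj L) 3 H',
                Corresponds (UnitaryGroup.conjMixed (↥(maximalRealSubfield L)) L (IsCMField.complexConj L)) (UnitaryGroup.archFormOf L 3 H')
                  (UnitaryGroup.archFormOf L 3 (Matrix.of fun i j : Fin 3 => if i.val + j.val + 1 = 3 then (1 : L) else 0)) γ' γ →
                  archStableOrbitalIntegral L 3 H' m' a' γ' = 0 :=
  exists_isCompact_archStableOrbitalIntegral_eq_zero_of_corresponds L H' (forall_place_engine_three L) m' ha'

/-- **THE ORGAN O2″, UNCONDITIONAL, for `a′ ∈ C_c^∞(G′_∞)`** (★ `ArchSmooth`) — the binder shape of the LH2 pay-down skeleton's organ texts.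
[cite: Rogawski1990, §14.2 (14.2.1) pp. 232–233] [cite: Shelstad2012, Cor. 2.2 p. 1926] -/
theorem exists_isCompact_archStableOrbitalIntegral_eq_zero_of_corresponds_of_archSmooth'
    {_hγ' : ∀ γ : UnitaryGroup.arch (↥(maximalRealSubfield L)) L (IsCMField.complexConj L) 3 H',
      MeasurableSpace (UnitaryGroup.arch (↥(maximalRealSubfield L)) L (IsCMField.complexConj L) 3 H' ⧸
        Subgroup.centralizer ({γ} : Set (UnitaryGroup.arch (↥(maximalRealSubfield L)) L (IsCMField.complexConj L) 3 H')))}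
    (m' : OrbitalMeasureFamily (UnitaryGroup.arch (↥(maximalRealSubfield L)) L (IsCMField.complexConj L) 3 H'))
    {a' : UnitaryGroup.arch (↥(maximalRealSubfield L)) L (IsCMField.complexConj L) 3 H' → ℂ} (ha' : ArchSmooth L 3 H' a') :
    ∃ C : Set (UnitaryGroup.arch (↥(maximalRealSubfield L)) L (IsCMField.complexConj L) 3 (Matrix.of fun i j : Fin 3 => if i.val + j.val + 1 = 3 then (1 : L) else 0)),
      IsCompact C ∧
        ∀ γ : UnitaryGroup.arch (↥(maximalRealSubfield L)) L (IsCMField.complexConj L) 3 (Matrix.of fun i j : Fin 3 => if i.val + j.val + 1 = 3 then (1 : L) else 0),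
          IsRegularElt (γ : GL (Fin 3) (mixedSpace L)) →
            (∀ δ : UnitaryGroup.arch (↥(maximalRealSubfield L)) L (IsCMField.complexConj L) 3 (Matrix.of fun i j : Fin 3 => if i.val + j.val + 1 = 3 then (1 : L) else 0),
              IsStablyConj (UnitaryGroup.conjMixed (↥(maximalRealSubfield L)) L (IsCMField.complexConj L))
                (UnitaryGroup.archFormOf L 3 (Matrix.of fun i j : Fin 3 => if i.val + j.val + 1 = 3 then (1 : L) else 0)) γ δ → δ ∉ C) →
              ∀ γ' : UnitaryGroup.arch (↥(maximalRealSubfield L)) L (IsCMField.complexConj L) 3 H',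
                Corresponds (UnitaryGroup.conjMixed (↥(maximalRealSubfield L)) L (IsCMField.complexConj L)) (UnitaryGroup.archFormOf L 3 H')
                  (UnitaryGroup.archFormOf L 3 (Matrix.of fun i j : Fin 3 => if i.val + j.val + 1 = 3 then (1 : L) else 0)) γ' γ →
                  archStableOrbitalIntegral L 3 H' m' a' γ' = 0 :=
  exists_isCompact_archStableOrbitalIntegral_eq_zero_of_corresponds L H' (forall_place_engine_three L) m' ha'.hasCompactSupport

end Unconditional

end Literature.NumberTheory.Rogawski1990

end
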